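import Summits.QuantumFields.YangMills.Theorems.BalabanUVNodesN18KernelLettersJunctions
import Literature.MathematicalPhysics.QuantumFieldTheory.Balaban1983to89.Node00.U3KernelLetters2

/-!
# BalabanUVNodes ∕ N18 — (J2) LETTER-KEYED END TO END: node U3's decay slot and node N17's scale-shift rate of the merged β FROM THE DEFINERS'
# UNIFORM WINDOWED (5.10) LETTER `WindowedDecayUniform(OfRecord₁₃)` (node00-def-W1 W1-19c `Node00/U3KernelLetters2`) + the N18 letter + (1.21) existence —
# generic, at the record, and from the three FINITE-VOLUME letters of record (Track A, DAG node N18 = NE5 → N17; key K3⁷ `SpineGivenEndpointR13SepCoPH`, skeleton v4)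

HONEST FRAMING.  Count-neutral kernel bookkeeping (seat `pub-ymgap-dag-n18-w1` g2; `--supports stmt-QuantumFields-20544`, helper lane): the v1.0 re-key of this
seat's `…N18KernelLettersJunctions` (J2) at W1-19c's letter NAMES (plan g82 WORDS-1 row n18 «w1 take (a)»).  Every input is a DISPLAY LETTER asserted for nothing
(`KernelStepRate(OfRecord₁₃)`, `PolLimitsExist(Box)(OfRecord₁₃)`, `WindowedStepRateOfRecord₁₃`, `WindowedDecayUniform(OfRecord₁₃)`); nothing of Bałaban's is
asserted; NE5 ∕ NE4 ∕ (5.10)-at-finite-volume NOT PRINTED as such ∕ NOT proved; N18 ∕ N17 NOT discharged; K3⁷ OPEN, not claimed; counts unmoved.  One finite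
four-torus programme at fixed ε — R4 closes the conditional rung `BalabanLadder.UV` only; nothing continuum ∕ ℝ⁴ ∕ OS ∕ mass gap ∕ Clay.  THEOREMS ONLY: 0 `def`, 0 `sorry`.

WHAT.  `decayBound_EA_of_windowedDecayUniform` (generic: `PolLimitsExist … W` ∧ `WindowedDecayUniform … W E₀ δ` ⟹ `DecayBound (EA …) W E₀ δ`) ·
`scaleShiftRate_betaMerged_of_kernelStepRate_of_windowedDecayUniform` (generic (J2) at the letter) · `scaleShiftRate_betaMergedOfRecord_of_uniformLetter`
(record (J2): `KernelStepRateOfRecord₁₃` ∧ `0 < ℓ.κ` ∧ `0 < δ` ∧ `PolLimitsExistOfRecord₁₃` ∧ `WindowedDecayUniformOfRecord₁₃ F N θ E₀ δ` ⟹ the scale-shift rate of the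
merged β of record) · ★ `scaleShiftRate_betaMergedOfRecord_of_finiteVolumeLetters` (ALL-FINITE-VOLUME form: `PolLimitsExistOfRecord₁₃` ∧ `WindowedStepRateOfRecord₁₃ …
s ℓ.κ ℓ.θ₅ (ℓ.C₅·ℓ.θ₅)` ∧ `WindowedDecayUniformOfRecord₁₃ … E₀ δ` ∧ `0 < ℓ.κ` ∧ `0 < δ` ⟹ `ScaleShiftRate (betaPrime510 4 (ℓ.C₅·ℓ.θ₅) ℓ.κ) ℓ.θ₅ θ.γ (betaMerged F ℰ_rec θ.ρ8 θ.bV)`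
— node N17's rate half of the merged β of record from three finite-volume display letters and the printed-claim existence letter, BY NAME).

Sources (types only): T. Bałaban, CMP **109** (1987) [Balaban1987RG1] Thm 1 p. 259, (1.18) p. 263, (1.20)–(1.22) p. 264, (1.6) p. 261, (5.10) p. 293.
Nothing here is a claim about the Yang–Mills mass gap.
-/

noncomputable section

namespace YMDAG.N18.KernelLettersJunctions

open scoped BigOperators
open Literature.MathematicalPhysics.QuantumFieldTheory.Balaban1983to89
open Literature.MathematicalPhysics.QuantumFieldTheory.Balaban1983to89.T4Continuum (T4Family)
open Literature.MathematicalPhysics.QuantumFieldTheory.Balaban1983to89.T4OutputRate (Window DecayBound)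
open Literature.MathematicalPhysics.QuantumFieldTheory.Balaban1983to89.T4CouplingMatching (ScaleShiftRate)
open Literature.MathematicalPhysics.QuantumFieldTheory.Balaban1983to89.B12Sec2to5 (betaPrime510)
open Node00 (U3Letters₁₁ Stage13Params TermFamily1 betaMerged)
open Node00.U3KernelLetters (KernelStepRate PolLimitsExist KernelStepRateOfRecord₁₃ PolLimitsExistOfRecord₁₃ WindowedStepRateOfRecord₁₃)
open Node00.U3KernelLetters2 (WindowedDecayUniform WindowedDecayUniformOfRecord₁₃)
open YMDAG.N18.AtRecordOfKernelLetters (kernelStepRateOfRecord₁₃_of_windowed')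

section Generic

variable {𝔄 : Type*} [NormedRing 𝔄] [NormedAlgebra ℝ 𝔄]
variable {V : Type*} [NormedAddCommGroup V] [NormedSpace ℝ V] {ι : Type*} [Fintype ι]
variable (F : T4Family) (ℰ : TermFamily1 F 𝔄) (ρ : V →L[ℝ] 𝔄) (bV : Module.Basis ι ℝ V)

/-- **NODE U3's DECAY SLOT FROM THE LETTERS** `PolLimitsExist … W` and W1-19c's `WindowedDecayUniform … W E₀ δ` (v1.0's `decayBound_EA_of_windowedUniform` at the
letter name; definitional). [cite: Balaban1987RG1, (1.18) p.263 and (5.10) p.293] -/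
theorem decayBound_EA_of_windowedDecayUniform {W : Set (ℕ → ℝ)} {E₀ δ : ℝ} (hlim : PolLimitsExist F ℰ ρ bV W)
    (hU : WindowedDecayUniform F ℰ ρ bV W E₀ δ) : DecayBound (Node00.U3OfKernels.EA F ℰ ρ bV) W E₀ δ :=
  decayBound_EA_of_windowedUniform F ℰ ρ bV hlim hU

variable {N : ℕ} [NeZero N]

/-- **(J2) AT THE LETTERS**: `KernelStepRate … θ.γ ℓ.κ ℓ.θ₅ ℓ.C₅` ∧ `0 < ℓ.κ` ∧ `0 < δ` ∧ `PolLimitsExist … (Window θ.γ)` ∧ `WindowedDecayUniform … (Window θ.γ) E₀ δ` ⟹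
`ScaleShiftRate (betaPrime510 4 (ℓ.C₅·ℓ.θ₅) ℓ.κ) ℓ.θ₅ θ.γ (betaMerged F ℰ ρ bV)`. [cite: Balaban1987RG1, (1.18) p.263, (1.20)–(1.22) p.264 and (5.10) p.293] -/
theorem scaleShiftRate_betaMerged_of_kernelStepRate_of_windowedDecayUniform (θ : Stage13Params F N) (ℓ : U3Letters₁₁)
    (h18 : KernelStepRate F ℰ ρ bV θ.γ ℓ.κ ℓ.θ₅ ℓ.C₅) (hκ : 0 < ℓ.κ) {E₀ δ : ℝ} (hδ : 0 < δ)
    (hlim : PolLimitsExist F ℰ ρ bV (Window θ.γ)) (hU : WindowedDecayUniform F ℰ ρ bV (Window θ.γ) E₀ δ) :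
    ScaleShiftRate (betaPrime510 4 (ℓ.C₅ * ℓ.θ₅) ℓ.κ) ℓ.θ₅ θ.γ (betaMerged F ℰ ρ bV) :=
  scaleShiftRate_betaMerged_of_kernelStepRate_of_windowedUniform F ℰ ρ bV θ ℓ h18 hκ hδ hlim hU

end Generic

section Record

open scoped Matrix.Norms.L2Operator

variable (F : T4Family) (N : ℕ) [NeZero N]

/-- **(J2) AT THE RECORD, LETTER-KEYED**: `KernelStepRateOfRecord₁₃ F N θ ℓ.κ ℓ.θ₅ ℓ.C₅` ∧ `0 < ℓ.κ` ∧ `0 < δ` ∧ `PolLimitsExistOfRecord₁₃ F N θ` ∧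
`WindowedDecayUniformOfRecord₁₃ F N θ E₀ δ` ⟹ node N17's scale-shift rate of the merged β of record. [cite: Balaban1987RG1, (1.20)–(1.22) p.264 and (1.6) p.261] -/
theorem scaleShiftRate_betaMergedOfRecord_of_uniformLetter (θ : Stage13Params F N) (ℓ : U3Letters₁₁)
    (h18 : KernelStepRateOfRecord₁₃ F N θ ℓ.κ ℓ.θ₅ ℓ.C₅) (hκ : 0 < ℓ.κ) {E₀ δ : ℝ} (hδ : 0 < δ) (hlim : PolLimitsExistOfRecord₁₃ F N θ)
    (hU : WindowedDecayUniformOfRecord₁₃ F N θ E₀ δ) :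
    letI := θ.instVβ₁; letI := θ.instVβ₂; letI := θ.instιβ
    ScaleShiftRate (betaPrime510 4 (ℓ.C₅ * ℓ.θ₅) ℓ.κ) ℓ.θ₅ θ.γ
      (betaMerged F (Node00.mergedTermFamilyMatT F N (Node00.TβOfRecord₁₃ F N) (Node00.chiβOfRecord₁₃ F N θ) θ.εbg) θ.ρ8 θ.bV) :=
  scaleShiftRate_betaMergedOfRecord_of_letters F N θ ℓ h18 hκ hδ hlim hU

/-- ★ **NODE N17's SCALE-SHIFT RATE OF THE MERGED β OF RECORD FROM THE FINITE-VOLUME LETTERS OF RECORD**: `PolLimitsExistOfRecord₁₃` ((1.21) exists on the window),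
`WindowedStepRateOfRecord₁₃ F N θ s ℓ.κ ℓ.θ₅ (ℓ.C₅·ℓ.θ₅)` (node N18's finite-volume two-run rate), `WindowedDecayUniformOfRecord₁₃ F N θ E₀ δ` (uniform finite-volume (5.10)),
`0 < ℓ.κ`, `0 < δ` ⟹ `ScaleShiftRate (betaPrime510 4 (ℓ.C₅·ℓ.θ₅) ℓ.κ) ℓ.θ₅ θ.γ (betaMerged F ℰ_rec θ.ρ8 θ.bV)` — this seat's `kernelStepRateOfRecord₁₃_of_windowed'` then (J2).
[cite: Balaban1987RG1, Thm 1 p.259, (1.20)–(1.22) p.264, (1.6) p.261 and (5.10) p.293] -/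
theorem scaleShiftRate_betaMergedOfRecord_of_finiteVolumeLetters (θ : Stage13Params F N) (ℓ : U3Letters₁₁) (s : ℕ)
    (hlim : PolLimitsExistOfRecord₁₃ F N θ) (hfin : WindowedStepRateOfRecord₁₃ F N θ s ℓ.κ ℓ.θ₅ (ℓ.C₅ * ℓ.θ₅)) (hκ : 0 < ℓ.κ)
    {E₀ δ : ℝ} (hδ : 0 < δ) (hU : WindowedDecayUniformOfRecord₁₃ F N θ E₀ δ) :
    letI := θ.instVβ₁; letI := θ.instVβ₂; letI := θ.instιβ
    ScaleShiftRate (betaPrime510 4 (ℓ.C₅ * ℓ.θ₅) ℓ.κ) ℓ.θ₅ θ.γ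
      (betaMerged F (Node00.mergedTermFamilyMatT F N (Node00.TβOfRecord₁₃ F N) (Node00.chiβOfRecord₁₃ F N θ) θ.εbg) θ.ρ8 θ.bV) :=
  scaleShiftRate_betaMergedOfRecord_of_uniformLetter F N θ ℓ (kernelStepRateOfRecord₁₃_of_windowed' F N θ s hlim hfin) hκ hδ hlim hU

end Record

end YMDAG.N18.KernelLettersJunctions

end
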